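import Literature.MathematicalPhysics.QuantumFieldTheory.Balaban1983to89.B8Thm4SupportLocalPer

/-!
# `Balaban1983to89.B8Thm4InductionLocalG` — [Balaban1985RegularSpaces] THEOREM 4 (p. 88): THE LEVEL INDUCTION (pp. 88–89, 94–95) WITH THE
# **GAUGE-GROUP INVARIANT** — dag-n05-a's driver `B8Thm4InductionLocal.thm4_exists_all_levels` re-run so that every gauge transformation of the induction
# (`u₀ = 1`, `u_{m+1} = u_m·v`) takes values in a subgroup `G ≤ U(𝔸)`, the Proposition-5 sockets delivering `G`-valued `v` (print p. 76: «G = SU(N)»;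
# the τ-bodies `B8SockHFPTraceFree.sockHFP(₀)_body_of_join_RD_traceFree` + `B8SpecialUnitaryTrace.expUnit_I_smul_mem_specialUnitaryUnits` serve them)

statement-level skeleton of published theorems with citation tags; proofs where landed; nothing here is a claim about the Yang–Mills mass gap

T. Bałaban, *Spaces of regular gauge field configurations on a lattice and gauge fixing conditions*, Commun. Math. Phys. **99** (1985) 75–102
`[Balaban1985RegularSpaces]` ("B8"; journal page = PDF page + 74): Thm 4 p. 88, proof pp. 88–89 («by induction with respect to k») and pp. 94–95 ((1.107)–(1.111)),
Prop. 5 p. 94, Prop. 3 p. 87, p. 76 («we consider … G = SU(N)»).  STATUS: published, refereed.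

CITATION HEADER (lean-in-tree rule).  Cell `ym3-torus` (HUMAN RULING D-0037: YM₃ on T³ = ladder rung R3, NOT Clay), width seat `ym-ust-19200-w3` gen 7, row (τ-D) of
LEAD-H BOARD v3 «H = hSupUρ2 ⟸ hSiteRows» (the residue class [τ-DATUM] `hu₁SU`: the H-line's Theorem-4 junction call
`Summit.….HalvingP1FlatCoreSupplierInduction.datum_of_preGauge` reads lit `B8Thm4AtLandau138.thm4_exists_all_levels_landau138`, which is unitary-only).  WHAT IS REPRODUCED
= print's induction «u = u′u₁» (p. 94) with the group bookkeeping print leaves implicit (all gauge transformations `G`-valued), as a by-name twin of dag-n05-a's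
`thm4_exists_all_levels` (its proof VERBATIM; the step through `B8Thm4SupportLocalPer.thm4_exists_step_onBonds_supp_explicit` at `S := univ`, which exposes
`u_{m+1} = u_m·v`).  Kind «kernel-checked proof», theorems only: no `def`, no `… : Prop` fact, no `instance`, no `notation`, no existing module modified.
`--supports stmt-QuantumFields-19200`.

## WHAT IS CERTIFIED HERE (kernel; axioms `propext` ∕ `Classical.choice` ∕ `Quot.sound`)
* §1 ★★ `thm4_exists_all_levels_mem` — the driver with `G`-valued sockets and `G`-valued output (see its docstring).
* §2 ★★ `thm4_exists_all_levels_of_b9_mem` ∕ ★★★ `thm4_exists_all_levels_landau138_mem` — `B8Prop3GaugeFixedKLevel.thm4_exists_all_levels_of_b9` ∕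
  `B8Thm4AtLandau138.thm4_exists_all_levels_landau138` over §1 (Proposition 3's reset `hP3 := hP3_gaugeFixed_of_b9` BY NAME, sockets `H42`∕`H59` verbatim,
  `hP5base`∕`hP5` in `G`-form, conclusion `∀ x, u x ∈ G`).

HONEST SCOPE: bookkeeping over landed theorems; Propositions 3∕5 and [4] Thm 3.3 are NOT proved (sockets displayed); N05 NOT discharged; nothing continuum ∕
mass-gap ∕ Clay.  No `sorry`, no `def`.
-/

noncomputable section

open NormedSpace

namespace Literature.MathematicalPhysics.QuantumFieldTheory.Balaban1983to89.B8Thm4InductionLocalG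

open Complex (I)
open MatrixLog B7Prop1Explicit B7Prop2Explicit B7Prop1Local B7Eq92Concrete
open B8Ineq132 (covDerivFwd)
open B8Eq119TwistedAxial (Restr129)
open B8Eq184Proof (gaugeExp cfgExp)
open B8Thm4SupportLocalPer (thm4_exists_step_onBonds_supp_explicit)
open B8Thm4TruncationLocal (base_datum restr129_one)

-- `Site` alone could resolve to the torus sites of `Setup.lean`; re-export the `ℤ^d` sites of `B7Prop1Explicit`.
export B7Prop1Explicit (Site)

variable {d : ℕ}

/-! ## §1 The driver with the gauge-group invariant -/

section Main

variable {𝔸 : Type*} [CStarAlgebra 𝔸] [Nontrivial 𝔸]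
variable {L k : ℕ} {η : ℝ} {U₀ U' : Site d → Fin d → 𝔸ˣ} {a cstar α₄ : ℝ}

/-- One level up costs a factor `L` ((1.111) bookkeeping; as in `B8Thm4InductionLocal`). [cite: Balaban1985RegularSpaces, (1.111) p.95] -/
private theorem level_shift (hL1 : 1 ≤ L) (hη : 0 < η) (hc : 0 ≤ cstar) (j : ℕ) :
    cstar * ((L : ℝ) ^ j * η)⁻¹ = L * cstar * ((L : ℝ) ^ (j + 1) * η)⁻¹ ∧
      cstar * ((L : ℝ) ^ j * η)⁻¹ ≤ L * cstar * ((L : ℝ) ^ j * η)⁻¹ := by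
  have hLr : (1 : ℝ) ≤ L := by exact_mod_cast hL1
  have hL0 : (0 : ℝ) < L := by linarith
  have ht : 0 ≤ ((L : ℝ) ^ j * η)⁻¹ := by positivity
  refine ⟨?_, ?_⟩
  · rw [pow_succ]
    field_simp
  · calc cstar * ((L : ℝ) ^ j * η)⁻¹ = 1 * cstar * ((L : ℝ) ^ j * η)⁻¹ := by ring
      _ ≤ L * cstar * ((L : ℝ) ^ j * η)⁻¹ := by gcongr

/-- ★★ **THEOREM 4's LEVEL INDUCTION WITH THE GAUGE-GROUP INVARIANT** — ✓`B8Thm4InductionLocal.thm4_exists_all_levels` re-run so that the gauge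
transformations of the induction take values in a subgroup `G ≤ U(𝔸)` (print: `G = SU(N)`, p. 76): the Proposition-5 sockets `hP5base` ∕ `hP5` are asked
at a `G`-valued level datum `u₁` and DELIVER a `G`-valued `v` (their τ-bodies: `λ` trace-free ⇒ `v = e^{iλ} ∈ SU(N)`), the Proposition-3 reset `hP3` is
verbatim (unitary `u`), and the induction produces at every `m ≤ k` a `G`-VALUED `u` (`u₀ = 1`, `u_{m+1} = u_m·v`, closure of `G`) with (1.29), `W = U′^{u⁻¹}`
in the gauge `Lan m` and its exponent in the (1.69)∕`c⋆` shape on `E_j`, `j ≤ m` — everything else verbatim (step = ✓`thm4_exists_step_onBonds_supp_explicit`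
at `S := univ`, base datum `A₀ = (1∕iη) log U′`). [cite: Balaban1985RegularSpaces, Thm 4 p.88, proof pp.88–89 + 94–95, Prop. 5 (1.107)–(1.108) p.94, Prop. 3 p.87, p.76 («G = SU(N)»)] -/
theorem thm4_exists_all_levels_mem (hL1 : 1 ≤ L) (hη : 0 < η) (G : Subgroup 𝔸ˣ) (hG : G ≤ unitaryUnits 𝔸)
    (hU₀ : ∀ x κ, U₀ x κ ∈ unitaryUnits 𝔸) (hU' : ∀ x κ, U' x κ ∈ unitaryUnits 𝔸)
    (hcstar : 0 ≤ cstar) (hα₄ : 0 ≤ α₄) (hs₁ : α₄ ≤ 1 / 84) (hs₂ : L * cstar ≤ 1 / 12) (ha : a ≤ 1 / 4) (ha2 : 2 * a ≤ cstar)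
    (E : ℕ → Set (Site d × Fin d)) (hE : ∀ j, E (j + 1) ⊆ E j)
    (h66 : ∀ b ∈ E 0, ‖((U' b.1 b.2 : 𝔸ˣ) : 𝔸) - 1‖ ≤ a)
    (Λs : ℕ → ℕ → Set (Site d)) (Lan : ℕ → (Site d → Fin d → 𝔸ˣ) → Prop)
    (hP5base : ∃ (v : Site d → 𝔸ˣ) (lam : Site d → 𝔸), (∀ x, v x ∈ G) ∧
        (∀ j, j ≤ 1 → ∀ b ∈ E j, (v b.1 : 𝔸) = ((gaugeExp lam b.1 : 𝔸ˣ) : 𝔸) ∧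
          (v (b.1 + e b.2) : 𝔸) = ((gaugeExp lam (b.1 + e b.2) : 𝔸ˣ) : 𝔸)) ∧
        (∀ j, j ≤ 1 → ∀ b ∈ E j, ‖lam b.1‖ ≤ α₄ ∧ ((L : ℝ) ^ j * η) * ‖covDerivFwd η U₀ b.2 lam b.1‖ ≤ α₄) ∧
        Lan 1 (mgauge U₀ v⁻¹ U') ∧ Restr129 L 1 (Λs 1) U₀ ((1 : Site d → 𝔸ˣ) * v))
    (hP5 : ∀ m, 1 ≤ m → m < k → ∀ (u₁ : Site d → 𝔸ˣ) (U₁ : Site d → Fin d → 𝔸ˣ) (A : Site d → Fin d → 𝔸),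
      (∀ x, u₁ x ∈ G) → mgauge U₀ u₁ U₁ = U' → Restr129 L m (Λs m) U₀ u₁ → Lan m U₁ →
      (∀ j, j ≤ m → ∀ b ∈ E j, U₁ b.1 b.2 = cfgExp η A b.1 b.2 ∧ IsSelfAdjoint (A b.1 b.2) ∧ ‖A b.1 b.2‖ ≤ cstar * ((L : ℝ) ^ j * η)⁻¹) →
      ∃ (v : Site d → 𝔸ˣ) (lam : Site d → 𝔸), (∀ x, v x ∈ G) ∧
        (∀ j, j ≤ m + 1 → ∀ b ∈ E j, (v b.1 : 𝔸) = ((gaugeExp lam b.1 : 𝔸ˣ) : 𝔸) ∧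
          (v (b.1 + e b.2) : 𝔸) = ((gaugeExp lam (b.1 + e b.2) : 𝔸ˣ) : 𝔸)) ∧
        (∀ j, j ≤ m + 1 → ∀ b ∈ E j, ‖lam b.1‖ ≤ α₄ ∧ ((L : ℝ) ^ j * η) * ‖covDerivFwd η U₀ b.2 lam b.1‖ ≤ α₄) ∧
        Lan (m + 1) (mgauge U₀ v⁻¹ U₁) ∧ Restr129 L (m + 1) (Λs (m + 1)) U₀ (u₁ * v))
    (hP3 : ∀ m, 1 ≤ m → m ≤ k → ∀ (u : Site d → 𝔸ˣ) (W : Site d → Fin d → 𝔸ˣ) (A : Site d → Fin d → 𝔸),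
      (∀ x, u x ∈ unitaryUnits 𝔸) → mgauge U₀ u W = U' → Restr129 L m (Λs m) U₀ u → Lan m W →
      (∀ j, j ≤ m → ∀ b ∈ E j, W b.1 b.2 = cfgExp η A b.1 b.2 ∧ ‖A b.1 b.2‖ ≤ (2 * (L * cstar) + 8 * α₄) * ((L : ℝ) ^ j * η)⁻¹) →
      ∀ j, j ≤ m → ∀ b ∈ E j, ‖A b.1 b.2‖ ≤ cstar * ((L : ℝ) ^ j * η)⁻¹) :
    ∀ m, m ≤ k → ∃ u : Site d → 𝔸ˣ, (∀ x, u x ∈ G) ∧ Restr129 L m (Λs m) U₀ u ∧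
      ∃ W : Site d → Fin d → 𝔸ˣ, mgauge U₀ u W = U' ∧ (1 ≤ m → Lan m W) ∧
        ∃ A : Site d → Fin d → 𝔸, ∀ j, j ≤ m → ∀ b ∈ E j,
          W b.1 b.2 = cfgExp η A b.1 b.2 ∧ IsSelfAdjoint (A b.1 b.2) ∧ ‖A b.1 b.2‖ ≤ cstar * ((L : ℝ) ^ j * η)⁻¹ := by
  have hLc : 0 ≤ L * cstar := by positivity
  -- reading a `c⋆`-bound at levels `≤ m` as an `Lc⋆`-bound at levels `≤ m + 1` (`E` antitone)
  have hshift : ∀ (m : ℕ) (A : Site d → Fin d → 𝔸),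
      (∀ j, j ≤ m → ∀ b ∈ E j, ‖A b.1 b.2‖ ≤ cstar * ((L : ℝ) ^ j * η)⁻¹) →
      ∀ j, j ≤ m + 1 → ∀ b ∈ E j, ‖A b.1 b.2‖ ≤ L * cstar * ((L : ℝ) ^ j * η)⁻¹ := by
    intro m A h j hj b hb
    rcases Nat.lt_or_ge j (m + 1) with hjm | hjm
    · exact (h j (by omega) b hb).trans (level_shift hL1 hη hcstar j).2
    · obtain rfl : j = m + 1 := le_antisymm hj hjm
      have h' := h m le_rfl b (hE m hb)
      rw [(level_shift hL1 hη hcstar m).1] at h'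
      exact h'
  -- THE COMMON TAIL OF A STEP: level-`m` datum + Proposition 5's data at level `m + 1` ⇒ the conclusion at level `m + 1`
  -- (`thm4_exists_step_onBonds` with `c := Lc⋆`, then the reset `hP3 (m + 1)`)
  have tail : ∀ m, m < k → ∀ (u₁ : Site d → 𝔸ˣ) (U₁ : Site d → Fin d → 𝔸ˣ) (A : Site d → Fin d → 𝔸),
      (∀ x, u₁ x ∈ G) → mgauge U₀ u₁ U₁ = U' →
      (∀ j, j ≤ m → ∀ b ∈ E j, U₁ b.1 b.2 = cfgExp η A b.1 b.2 ∧ IsSelfAdjoint (A b.1 b.2) ∧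
        ‖A b.1 b.2‖ ≤ cstar * ((L : ℝ) ^ j * η)⁻¹) →
      ∀ (v : Site d → 𝔸ˣ) (lam : Site d → 𝔸), (∀ x, v x ∈ G) →
        (∀ j, j ≤ m + 1 → ∀ b ∈ E j, (v b.1 : 𝔸) = ((gaugeExp lam b.1 : 𝔸ˣ) : 𝔸) ∧
          (v (b.1 + e b.2) : 𝔸) = ((gaugeExp lam (b.1 + e b.2) : 𝔸ˣ) : 𝔸)) →
        (∀ j, j ≤ m + 1 → ∀ b ∈ E j, ‖lam b.1‖ ≤ α₄ ∧ ((L : ℝ) ^ j * η) * ‖covDerivFwd η U₀ b.2 lam b.1‖ ≤ α₄) →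
        Lan (m + 1) (mgauge U₀ v⁻¹ U₁) → Restr129 L (m + 1) (Λs (m + 1)) U₀ (u₁ * v) →
      ∃ u : Site d → 𝔸ˣ, (∀ x, u x ∈ G) ∧ Restr129 L (m + 1) (Λs (m + 1)) U₀ u ∧
        ∃ W : Site d → Fin d → 𝔸ˣ, mgauge U₀ u W = U' ∧ (1 ≤ m + 1 → Lan (m + 1) W) ∧
          ∃ A' : Site d → Fin d → 𝔸, ∀ j, j ≤ m + 1 → ∀ b ∈ E j,
            W b.1 b.2 = cfgExp η A' b.1 b.2 ∧ IsSelfAdjoint (A' b.1 b.2) ∧ ‖A' b.1 b.2‖ ≤ cstar * ((L : ℝ) ^ j * η)⁻¹ := by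
    intro m hmk u₁ U₁ A hu₁ hU₁ hA v lam hv hvlam h108 hLan h129
    -- `U₁ = e^{iηA}` and (1.69) with `c = Lc⋆` on `E j`, `j ≤ m + 1`
    have hAexp : ∀ j, j ≤ m + 1 → ∀ b ∈ E j, U₁ b.1 b.2 = cfgExp η A b.1 b.2 := by
      intro j hj b hb
      rcases Nat.lt_or_ge j (m + 1) with hjm | hjm
      · exact (hA j (by omega) b hb).1
      · obtain rfl : j = m + 1 := le_antisymm hj hjm
        exact (hA m le_rfl b (hE m hb)).1
    have h69 := hshift m A (fun j hj b hb => (hA j hj b hb).2.2)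
    -- the step with the new gauge transformation EXPOSED as `u₁·v` (so that `G`-membership propagates)
    obtain ⟨-, -, h29, hW, hLanW, hA'⟩ := thm4_exists_step_onBonds_supp_explicit (k := m + 1) (Λ := Λs (m + 1)) hL1 hη hU₀ hU'
      (fun x => hG (hu₁ x)) (fun x => hG (hv x)) (Set.univ : Set (Site d)) (fun x hx => absurd (Set.mem_univ x) hx)
      (fun x hx => absurd (Set.mem_univ x) hx) hLc hα₄ hs₁ hs₂ hU₁ E hAexp h69 hvlam h108 (Lan (m + 1)) hLan h129
    have hu : ∀ x, (u₁ * v) x ∈ G := fun x => by rw [Pi.mul_apply]; exact G.mul_mem (hu₁ x) (hv x)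
    -- Proposition 3 at level `m + 1`: reset the constant `2Lc⋆ + 8α₄ ↦ c⋆`
    have hreset := hP3 (m + 1) (by omega) (by omega) (u₁ * v) _ _ (fun x => hG (hu x)) hW h29 hLanW
      (fun j hj b hb => ⟨(hA' j hj b hb).1, (hA' j hj b hb).2.2⟩)
    exact ⟨u₁ * v, hu, h29, _, hW, fun _ => hLanW, _, fun j hj b hb => ⟨(hA' j hj b hb).1, (hA' j hj b hb).2.1, hreset j hj b hb⟩⟩
  -- THE BASE DATUM: `u = 1`, `W = U′`, `A₀ = (1/iη) log U′`
  have base : ∀ j, j ≤ 0 → ∀ b ∈ E j,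
      U' b.1 b.2 = cfgExp η (fun y μ => η⁻¹ • ((I⁻¹ : ℂ) • mlog ((U' y μ : 𝔸ˣ) : 𝔸))) b.1 b.2 ∧
        IsSelfAdjoint ((fun y μ => η⁻¹ • ((I⁻¹ : ℂ) • mlog ((U' y μ : 𝔸ˣ) : 𝔸))) b.1 b.2) ∧
        ‖(fun y μ => η⁻¹ • ((I⁻¹ : ℂ) • mlog ((U' y μ : 𝔸ˣ) : 𝔸))) b.1 b.2‖ ≤ cstar * ((L : ℝ) ^ j * η)⁻¹ := by
    intro j hj b hb
    obtain rfl : j = 0 := Nat.le_zero.mp hj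
    obtain ⟨-, hexp, hsa, hbd⟩ := base_datum hη U₀ U' hU' ha b.1 b.2 (h66 b hb)
    refine ⟨hexp, hsa, hbd.trans ?_⟩
    rw [pow_zero, one_mul]
    exact mul_le_mul_of_nonneg_right ha2 (inv_nonneg.mpr hη.le)
  have hone : mgauge U₀ (1 : Site d → 𝔸ˣ) U' = U' := by
    funext z μ; simp [mgauge_apply]
  intro m
  induction m with
  | zero =>
    intro _
    exact ⟨1, fun _ => G.one_mem, restr129_one L 0 (Λs 0) U₀, U', hone, fun h => absurd h (by omega), _, base⟩
  | succ m ih =>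
    intro hmk
    rcases Nat.eq_zero_or_pos m with rfl | hm
    · -- the first step («k = 1»): Proposition 5 for the base datum
      obtain ⟨v, lam, hv, hvlam, h108, hLan, h129⟩ := hP5base
      exact tail 0 (by omega) 1 U' _ (fun _ => G.one_mem) hone base v lam hv hvlam h108 hLan h129
    · -- the general step: Proposition 5 for the datum delivered at level `m`
      obtain ⟨u₁, hu₁, h129₁, U₁, hU₁, hLan₁, A, hA⟩ := ih (by omega)
      obtain ⟨v, lam, hv, hvlam, h108, hLan, h129⟩ := hP5 m hm (by omega) u₁ U₁ A hu₁ hU₁ h129₁ (hLan₁ hm) hA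
      exact tail m (by omega) u₁ U₁ A hu₁ hU₁ hA v lam hv hvlam h108 hLan h129

end Main

end Literature.MathematicalPhysics.QuantumFieldTheory.Balaban1983to89.B8Thm4InductionLocalG

end
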